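import Mathlib
import HarnessLib
import Summits.ValiantsHypothesis.ValiantsHypothesis.Theses.ValuativeGCT
import Summits.ValiantsHypothesis.ValiantsHypothesis.Theorems.ValuativeGCTValuativeFlipTailSuffices

/-!
# FALLBACK skeleton (logarithmic guard `ℓ(λ) ≤ log₂ m + 1`) — line `adjugate-slice-cut` for crux `ValuativeGCT.ValuativeFlip` (stmt-ValiantsHypothesis-12624)

Crux-strategist gen 2 (planner-cstrat-stmt-ValiantsHypothesis-12624-p1-0, 2026-08-17), wall-breaker on the
exhausted chain.  Line card: `Cruxes/ValuativeFlip/Lines/adjugate-slice-cut.md`; census: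
`Cruxes/ValuativeFlip/STRATEGY-CENSUS.md` (gen 2); data: kit jobs j021432 / j021445 / j021456 / j021513 / j021553 / j021632 / j021643
(`Cruxes/ValuativeFlip/SliceCutCensus.md`).

Letters: level `m`, degree `δ`, a δ-SATURATED shape `λ ⊢ m·δ` is one with first row EXACTLY `(m-1)·δ`
(`lam.parts.sup = (m-1)*δ`), i.e. `λ = ((m-1)δ) ∪ μ̄` with BODY `μ̄ ⊢ δ` (`b = |μ̄| = δ`; the flip regime
`b > m` of `noSmallBodyFlip` is `δ > m`).  `T_U(λ*)` = the crux's valuative truncation (`truncT` below, verbatim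
the crux's `let T`), `K_m(λ*) = orbitMultiplicity ℂ (detFormLex ℂ m) m λ*`, `P(n,m,λ*) = orbitMultiplicity ℂ
(paddedPerFormLex ℂ n m) m λ*`, `λ* = partitionWeightLex m λ`.  Centres: `Λ_m` = skew-symmetric matrices
(`m` odd; rank `≤ m-1`, nc-rank `m`), `Λ_{m-1} ⊕ E_{mm}` (`m` even; rank `≤ m-1`, nc-rank `m`).

## The lever (ADJUGATE SLICE; card §Idea)
On the dense open set `{A_top invertible}` every `G ∈ T_⊥(λ*)` at a δ-saturated `λ` is
`G(A) = g(adj(A_top)·A_{top-1}, …, adj(A_top)·A_{top-p})` for a unique conjugation-, transpose- and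
translation-invariant `U`-fixed multihomogeneous `g` on `(𝔰𝔩_m)^p` of multidegree `μ̄` (so `dim T_⊥ =
dim (S_μ̄ 𝔰𝔩_m)^{GL_m ⋊ ℤ/2}`, Manivel's number); `K_m(λ*)` is the dimension of those `g` that are polynomials
in the coefficients of the PENCIL CHARACTERISTIC POLYNOMIAL `det(t·1 + Σ_i x_i B_i)`; and `G ∈ T_U(λ*)` iff
`ord_ε g(adj(Y_top + εZ_top)(Y_i + εZ_i)) ≥ δ(m-r)` at generic `Y ∈ U^{p+1}` (rank-one tuples `-k u_iᵀ`,
`u_i ⊥ k`).  Equivalently (homogeneity, `adj = det · inverse`, `ord_ε det(Y_top + εZ_top) = 1`): `G ∈ T_{Λ_m}(λ*)` iff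
`g((Y_top+εZ_top)⁻¹(Y_i+εZ_i))` has NO POLE at `ε = 0` along generic skew arcs.  In this model the three numbers
`dim T_⊥ ≥ dim T_U ≥ K_m` are finite linear algebra; the census (`SliceCutCensus.md`: 180+ Edmonds-gap instances,
`3 ≤ m ≤ 9`, `2 ≤ δ ≤ 12`, bodies of 2–7 rows) finds `dim T_U(λ*) = K_m(λ*)` EXACTLY in every instance with `m ≥ 5`
and `ℓ(λ) ≤ m - 1` (the cut removes up to `8/9` of `dim T_⊥`: `(δ, μ̄) = (9, (5,2,2))` at `m = 7`: `45 → 5`; at `m = 5`: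
`38 → 5`; `(8,(5,2,1))`: `12 → 2`), while EVERY observed leak has `ℓ(λ) ≥ m`: sizes 1–4 at `m = 3` (22 bodies), one at
`m = 4` (`(3,1,1,1)`), one at `m = 5` (`(δ, μ̄) = (8, (2,2,2,2))`: `dim T_Λ = 2 > K_5 = 1`); and `K_m = a_λ(δ[m])`
(no equation of `Det_m`) in every instance.  Hence the guard `ℓ(λ) ≤ m - 1` in the cut stubs (harmless for the
residual, which needs only `ℓ(λ) ≳ log_{n+1} m` rows).

## Stubs (three; all load-bearing in `ValuativeFlip_of`)
* `stub_skewCutExact_odd`  (NEW, XL; the lever as a theorem): for odd `m ≥ 5` the skew truncation is EXACT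
  on δ-saturated shapes with `ℓ(λ) ≤ m - 1`: `dim T_{Λ_m}(λ*) ≤ K_m(λ*)` (`≥` is `ValuativeBound`), together with
  the rank bound `rank ≤ m-1` on `Λ_m` that makes `(Λ_m, m-1)` an admissible centre of the crux.
* `stub_skewCutExact_even` (NEW, XL): the same for even `m ≥ 6` with the Edmonds-gap centre `Λ_{m-1} ⊕ E_mm`.
* `stub_satMultFlip` (RESIDUAL, OPEN — honest label: a Mulmuley–Sohoni multiplicity flip, = `GCTMult.GctMultFlip`
  (stmt-0887) with witnesses restricted to δ-saturated shapes, in the polynomially padded tail `n² ≤ m`):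
  `K_m(λ*) < P(n,m,λ*)` for some δ-saturated `λ` with `ℓ(λ) ≤ m - 1` at every tail position.  In the slice model: the `μ̄`-isotypic
  HWV part of the ring generated by the mixed elementary symmetric functions of `p ≤ n²` generic `m × m`
  matrices is SMALLER than the padded permanent's multiplicity; the per side is `m`-free from below
  (`perAnchorInheritance_every`: `P(n,m,λ*) ≥ P_n(((n-1)δ) ∪ μ̄)`).
Composition: `polyPadded 2` → at a tail position take `(δ, λ)` from the residual, the centre by parity, and
`dim T_U(λ*) ≤ K_m(λ*) < P(n,m,λ*)`.

## Disproof used (`Cruxes/ValuativeFlip/Disproof.lean`, cdisprove; CutBites/Negative)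
F4 (`valuativeFlipWithoutRankBound_holds`: the rank bound is load-bearing) — honoured: both cut stubs carry
`rank ≤ m - 1 < m` and the cut is the Edmonds-gap cut, not `U = ⊤`; F5b/`no_oneRow_flip` and the 3-row
no-go — honoured: saturated witnesses of the residual need `≥ 4` rows (the card records `ℓ(λ) > log_{n+1} m`);
F6 (`truncT_eq_truncT₀_of_equiv_compression`: null-cone centres cut nothing) — honoured: `Λ_m` and
`Λ_{m-1} ⊕ E` have nc-rank `m`; F7 (CutBites at `m = 3`) and `CutBites.Negative.NormalOrderParityLaw` /
`NoJumpAtWrongParity` — honoured: for odd `m` the threshold `δ(m-r) = δ ≡ mδ (mod 2)` is a legal jump of the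
`Λ_m`-filtration; T5 (`noSmallBodyFlip`): residual witnesses have `δ = b > m`.  No `-- Targets` stub of the
disprover is an instance of these stubs; no landed `Negative/` lemma refutes an instance (checked:
`ValuativeGCTNoValuativeFlip*`: bounded length / outside-KL / occurrence — saturated shapes are KL-admissible,
`λ₁ = (m-1)δ ≥ δ(m-n)`, and of unbounded length).
-/

namespace Summit.ValiantsHypothesis.ValiantsHypothesis.Cruxes.ValuativeFlip.AdjugateSliceCutLogGuard

open MvPolynomial
open scoped BigOperators Matrix
open Literature.NumberTheory.DiophantineGeometry
open Literature.Computability.AlgebraicComplexity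
open Literature.Computability.Complexity
open Summit.ValiantsHypothesis.ValiantsHypothesis.Theses.ValuativeGCT
open Summit.ValiantsHypothesis.ValiantsHypothesis.Theorems.ValuativeFlip

noncomputable section

set_option linter.dupNamespace false

/-! ## The objects (verbatim pieces of the crux) -/

/-- The crux's VALUATIVE TRUNCATION `T_U(χ)` (verbatim its `let T`, with `(U, r, δ, χ)` abstracted; =
`Cruxes/ValuativeFlip/Disproof.lean`'s `truncT`). [this crux] -/
def truncT (m : ℕ) (U : Submodule ℂ (MatIdx m → ℂ)) (r δ : ℕ) (χ : Weight (MatIdx m)) :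
    Submodule ℂ (MvPolynomial (MatIdx m × MatIdx m) ℂ) :=
  MvPolynomial.homogeneousSubmodule (MatIdx m × MatIdx m) ℂ (m * δ) ⊓
    ((MvPolynomial.vanishingIdeal ℂ
      {p : MatIdx m × MatIdx m → ℂ | ∀ j : MatIdx m, (fun i => p (j, i)) ∈ U}) ^ (δ * (m - r))).restrictScalars ℂ ⊓
    (⨅ (M : Matrix (MatIdx m) (MatIdx m) ℂ) (_ : linSubst (MatIdx m) ℂ M (detFormLex ℂ m) = detFormLex ℂ m),
      LinearMap.ker ((MvPolynomial.aeval (R := ℂ) fun p : MatIdx m × MatIdx m =>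
        ∑ l : MatIdx m, M l p.2 • MvPolynomial.X (p.1, l)).toLinearMap -
        LinearMap.id (R := ℂ) (M := MvPolynomial (MatIdx m × MatIdx m) ℂ))) ⊓
    (⨅ (g : Matrix.GeneralLinearGroup (MatIdx m) ℂ) (_ : IsUpperTriangular g),
      LinearMap.ker ((MvPolynomial.aeval (R := ℂ) fun p : MatIdx m × MatIdx m =>
        ∑ l : MatIdx m, ((g⁻¹ : Matrix.GeneralLinearGroup (MatIdx m) ℂ) :
          Matrix (MatIdx m) (MatIdx m) ℂ) p.1 l • MvPolynomial.X (l, p.2)).toLinearMap -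
        weightChar χ g • LinearMap.id (R := ℂ) (M := MvPolynomial (MatIdx m × MatIdx m) ℂ)))

/-- The skew Edmonds-gap centre `Λ_m` (verbatim the `let U` of `CutBites`): for odd `m` every element is
singular (rank `≤ m - 1`) while the nc-rank is `m`. [this route, CutBites] -/
def skewCentre (m : ℕ) : Submodule ℂ (MatIdx m → ℂ) :=
  Submodule.span ℂ {u : MatIdx m → ℂ | ∀ a b : Fin m, u (toLex (a, b)) = -u (toLex (b, a))}

/-- The even-level Edmonds-gap centre `Λ_{m-1} ⊕ E_{mm}`: matrices whose top-left `(m-1) × (m-1)` block is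
skew, whose last row and column vanish off the diagonal, and whose `(m,m)` entry is free; for even `m` the
block has odd size, so rank `≤ (m-2) + 1 = m - 1`, nc-rank `m`. [this line] -/
def skewOneCentre (m : ℕ) : Submodule ℂ (MatIdx m → ℂ) :=
  Submodule.span ℂ {u : MatIdx m → ℂ |
    (∀ a b : Fin m, (a : ℕ) + 1 < m → (b : ℕ) + 1 < m → u (toLex (a, b)) = -u (toLex (b, a))) ∧
    (∀ a b : Fin m, ((a : ℕ) + 1 = m ∨ (b : ℕ) + 1 = m) → a ≠ b → u (toLex (a, b)) = 0)}

/-! ## Stub 1 — the lever, odd levels: the skew cut is EXACT on δ-saturated shapes -/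

/-- **stub_skewCutExact_odd** (NEW; XL — open algebraic core, census-backed).  For odd `m ≥ 5`: (i) `Λ_m` is an admissible centre with `r = m-1`
(every skew matrix of odd size is singular), and (ii) for every `δ` and every δ-saturated `λ ⊢ mδ` (first row
exactly `(m-1)δ`) with AT MOST `m - 1` PARTS the valuative truncation along `L_{Λ_m}` with threshold `δ(m-r) = δ`
is not larger than the determinant's orbit-closure multiplicity: `dim T_{Λ_m}(λ*) ≤ K_m(λ*)` — hence EQUAL, by
`ValuativeBound`.  Proof plan (card §Stubs): adjugate slice `G(A) = g(adj(A_top) A_i)` on `{det A_top ≠ 0}`;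
`K_m(λ*)` = the `g` that are polynomials in the pencil-charpoly coefficients (image of the orbit pull-back `Φ`
restricted to the slice); the cut = `ord_ε ≥ δ` for `g(adj(Y_top+εZ_top)(Y_i+εZ_i))` at skew `Y`; show every
cut-surviving `g` is a charpoly polynomial — equivalently: a conjugation invariant of `p` matrices that stays REGULAR along
every arc `(Y_top+εZ_top)⁻¹(Y_i+εZ_i)` into the odd-skew boundary is a polynomial in the pencil-charpoly coefficients
(which are regular there because an odd skew pencil has identically vanishing determinant).  Evidence
(`SliceCutCensus.md`, kit j021432/j021445/j021513/j021539): equality in EVERY computed instance with odd `m ≥ 5`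
and `ℓ(λ) ≤ m - 1` (`m = 5`: all bodies with `≤ 3` parts up to `δ = 12`; `m = 7`: `≤ 5` parts, `δ ≤ 10`; `m = 9`,
`δ = 10`).  Without the guard it FAILS: at `m = 3` (22 of 61 instances, `δ ≥ 6`), at `m = 4` (`(3,1,1,1)`) and ONCE at
`m = 5` (`δ = 8`, `μ̄ = (2,2,2,2)`, `ℓ(λ) = 5 = m`: `dim T_Λ = 2 > 1 = K_5`) — extra invariants integral over the
charpoly ring (functions on the normalisation, which NO valuation cuts); every observed leak has `ℓ(λ) ≥ m`, hence the
guards `5 ≤ m` and `lam.parts.card + 1 ≤ m` (the guard is fitted to the census, not derived).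
Why it might fail: an invariant integral over `ℂ[Δ(det_m)]` but outside it (a function on the NORMALISATION,
Kumar / BLMW §5) passes every valuative cut; the stub bets that none has a δ-saturated type with `ℓ(λ) ≤ m - 1`
for `m ≥ 5` — a bet fitted to 180+ computed instances, refutable by one more computation (`kit_slicecut/slicecut.py`).
[this line; Hüttenhain arXiv:1512.04352 Thm 4; Manivel arXiv:0907.3351 Thm 1; BLMW arXiv:0907.2850 §5;
Kumar arXiv:1109.5996] -/
theorem stub_skewCutExact_odd (m : ℕ) [NeZero m] (hodd : Odd m) (h5 : 5 ≤ m) :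
    (∀ u ∈ skewCentre m, (Matrix.of fun a b : Fin m => u (toLex (a, b))).rank ≤ m - 1) ∧
    ∀ (δ : ℕ) (lam : Nat.Partition (m * δ)), lam.parts.card ≤ Nat.log 2 m + 1 → lam.parts.sup = (m - 1) * δ →
      Module.finrank ℂ ↥(truncT m (skewCentre m) (m - 1) δ (partitionWeightLex m lam)) ≤
        orbitMultiplicity ℂ (detFormLex ℂ m) m (partitionWeightLex m lam) := by
  sorry

/-! ## Stub 2 — the lever, even levels: the `Λ_{m-1} ⊕ E` cut is EXACT on δ-saturated shapes -/

/-- **stub_skewCutExact_even** (NEW; XL, census-backed).  For even `m ≥ 6`: (i) `Λ_{m-1} ⊕ E_{mm}` is an admissible centre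
with `r = m-1`, and (ii) for every `δ` and every δ-saturated `λ ⊢ mδ` with at most `m - 1` parts,
`dim T_{Λ_{m-1} ⊕ E}(λ*) ≤ K_m(λ*)`.  Same slice mechanism (`adj(diag(S,c)) = diag(c·adj S, 0)` at a generic
point of the centre, rank one with kernel vector `(k,0)`).  Evidence (`SliceCutCensus.md`): all computed instances at
`m = 6` (13/13, `δ ≤ 7`, more in j021513/j021539) and `m = 8` exact; the analogous statement FAILS at `m = 4` for the
body `(3,1,1,1)`, `δ = 6` — hence the guard `6 ≤ m`.
Why it might fail: as for the odd stub (normalisation functions of saturated type), and the even centre is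
smaller (`dim = (m-1)(m-2)/2 + 1`), so its cut is weaker (`truncT_anti_space`). [this line] -/
theorem stub_skewCutExact_even (m : ℕ) [NeZero m] (heven : Even m) (h6 : 6 ≤ m) :
    (∀ u ∈ skewOneCentre m, (Matrix.of fun a b : Fin m => u (toLex (a, b))).rank ≤ m - 1) ∧
    ∀ (δ : ℕ) (lam : Nat.Partition (m * δ)), lam.parts.card ≤ Nat.log 2 m + 1 → lam.parts.sup = (m - 1) * δ →
      Module.finrank ℂ ↥(truncT m (skewOneCentre m) (m - 1) δ (partitionWeightLex m lam)) ≤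
        orbitMultiplicity ℂ (detFormLex ℂ m) m (partitionWeightLex m lam) := by
  sorry

/-! ## Stub 3 — the residual: a true multiplicity flip on δ-saturated shapes in the polynomially padded tail -/

/-- **stub_satMultFlip** (RESIDUAL, OPEN — crux-strength in `K`-currency: it is the Mulmuley–Sohoni
multiplicity flip `GCTMult.GctMultFlip` (stmt-0887) with witnesses restricted to δ-saturated shapes, on the
tail `n² ≤ m ≤ 2^((log₂ n + c)^c)`; by `valuativeFlip_iff_polyPadded 2` nothing is lost in the position).
For every `c`, eventually in `n`, at every such `(n, m)` there are `δ` and a δ-saturated `λ ⊢ mδ` (at most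
`m - 1` parts — the guard of the cut stubs; harmless here since witnesses need only `ℓ(λ) > log_{n+1} m` rows and
`ℓ(λ) ≤ n² + 1 ≤ m + 1` anyway — first row `(m-1)δ`) with `K_m(λ*) < P(n,m,λ*)`.  Slice model (card §Stubs): `K_m(λ*)` = the
`μ̄`-highest-weight part of the degree-`δ` piece of the algebra generated by the mixed elementary symmetric
functions `e_ᾱ(B_1,…,B_p)` of `p = ℓ(μ̄) ≤ n²` generic `m × m` matrices (coordinate ring of MONIC
DETERMINANTAL `(p+1)`-ary forms of degree `m`); the per side is `m`-free from below,
`P(n,m,λ*) ≥ P_n(((n-1)δ) ∪ μ̄)` (`perAnchorInheritance_every`), and `≤ Σ_{κ ≺ μ̄} P_n(((n-1)|κ|) ∪ κ)`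
(Pieri ceiling).  Constraints on witnesses (all landed): `δ = b > m` (`noSmallBodyFlip`), `ℓ(λ) > log_{n+1} m`
(bounded-length no-go), `ℓ(λ) ≤ n² + 1`, and `K_m(λ*) < a_λ(δ[m])` (an EQUATION of `Det_m` of type `λ`, i.e.
a relation among the `e_ᾱ` in weighted degree `δ`; none at any computed type, `m ≤ 9`, `δ ≤ 12`).
Why it might fail: exactly the crux's key risk in `K`-currency — beyond linear padding the determinant's
orbit closure may have at least as many functions of every saturated type as the padded permanent's
(IP17 Thm 4 analogue; no per-side engine past `√2·n`; no instance is computable).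
[MulmuleySohoni2008; BLMW arXiv:0907.2850 §4; arXiv:1911.03990; arXiv:1512.03798; this line] -/
theorem stub_satMultFlip :
    ∀ c : ℕ, ∃ n₀ : ℕ, ∀ n ≥ n₀, ∀ (m : ℕ) [NeZero m], n ^ 2 ≤ m → m ≤ 2 ^ ((Nat.log 2 n + c) ^ c) →
      ∃ (δ : ℕ) (lam : Nat.Partition (m * δ)), lam.parts.card ≤ Nat.log 2 m + 1 ∧ lam.parts.sup = (m - 1) * δ ∧
        orbitMultiplicity ℂ (detFormLex ℂ m) m (partitionWeightLex m lam) <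
          orbitMultiplicity ℂ (paddedPerFormLex ℂ n m) m (partitionWeightLex m lam) := by
  sorry

/-! ## Glue (sorry-free over the three stubs) -/

/-- **The crux from the stubs**, via the polynomially padded normal form of the crux
(`valuativeFlip_iff_polyPadded 2`): at a tail position `n² ≤ m` (`n ≥ 3`, so `m ≥ 9`) take `(δ, λ)` from
`stub_satMultFlip`, the Edmonds-gap centre of the right parity with `r = m - 1`, and chain
`dim T_U(λ*) ≤ K_m(λ*) < P(n,m,λ*)`. [this file] -/
theorem valuativeFlip_of_stubs : ValuativeFlip := by
  refine (valuativeFlip_iff_polyPadded 2 (by norm_num)).mpr fun c => ?_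
  obtain ⟨n₀, hn₀⟩ := stub_satMultFlip c
  refine ⟨max n₀ 3, fun n hn m _ hkm hm => ?_⟩
  have hn0 : n₀ ≤ n := le_of_max_le_left hn
  have h3 : 3 ≤ n := le_of_max_le_right hn
  have h9 : 9 ≤ n ^ 2 := by nlinarith
  have hm9 : 9 ≤ m := h9.trans hkm
  obtain ⟨δ, lam, hcard1, hsup, hlt⟩ := hn₀ n hn0 m hkm hm
  have hlog : Nat.log 2 m ≤ m := Nat.log_le_self 2 m
  have hcard : lam.parts.card ≤ m * m := by nlinarith
  rcases Nat.even_or_odd m with hev | hodd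
  · obtain ⟨hU, hcut⟩ := stub_skewCutExact_even m hev (by omega)
    exact ⟨skewOneCentre m, m - 1, δ, lam, hU, hcard, lt_of_le_of_lt (hcut δ lam hcard1 hsup) hlt⟩
  · obtain ⟨hU, hcut⟩ := stub_skewCutExact_odd m hodd (by omega)
    exact ⟨skewCentre m, m - 1, δ, lam, hU, hcard, lt_of_le_of_lt (hcut δ lam hcard1 hsup) hlt⟩

/-- **`ValuativeGCT.ValuativeFlip` BY NAME** from the three stubs. [this file] -/
theorem ValuativeFlip_of :
    Summit.ValiantsHypothesis.ValiantsHypothesis.Theses.ValuativeGCT.ValuativeFlip :=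
  valuativeFlip_of_stubs

end

end Summit.ValiantsHypothesis.ValiantsHypothesis.Cruxes.ValuativeFlip.AdjugateSliceCutLogGuard
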